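import Mathlib
import HarnessLib
import Summits.HubbardSuperconductivity.HubbardSuperconductivity.Theorems.KLProgrammeKLRegimeEngineLastStepResponseBracketFlowSharpEnv
import Summits.HubbardSuperconductivity.HubbardSuperconductivity.Theorems.KLProgrammeKLRegimeEngineLastStepAliasRows

/-!
# K3 gen-8-FLOW (stmt 20437, stub (C), located item #20, cure (δ′) «LAST-STEP SWAP», layer F3h): THE RESPONSE BRACKET AT THE FLOW FRAMES WITH THE ALIAS
# ROWS DISCHARGED AT THE REGISTERED VOLUME DOOR — `lastResponse_bracket_flow_sharp_alias`

Cell gate-hubbard-kl, seat p2 g20 («(δ′)-ALIAS-ROWS», step 4 = the composition).  `lastResponse_bracket_flow_sharp_env` (p632839) still read, besides the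
analytic/moment inputs, the Gevrey order `Mg ≥ 8`, six scalar symbol rows `hDg_X/hA₀_X`, the 21 alias/Bell rows `hAL_X`, `hAA_X0..4`, `hAA_Xs` on free
function parameters `AL_X, AA_X`, and three free sizes `ZA_X` inside the smallness `16·C·U ≤ 1`.  Here ALL of these are discharged: `Mg := 26`,
`Dg_X := EXPR_X(26)`, `A₀_X := EXPR_X(0)`, `AL_X j :=` the alias-row LHS itself, `AA_X k := a_X·P₄·lᵏ` (graded Bell rows of `…LastStepAliasArith`),
`a_a = klEngRsq R⁸/2^17·U³/β²`, `a_b = (Nm_b·klEngRsq R⁸/2⁶ + Ns_b/2^217)·U³/β²` (`…LastStepAliasRows` at `klEngL₄ P R β U ≤ L`), and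
`ZA_a := klEngRsq R⁸·P₄/2^30`, `ZA_b := (Nm_b·klEngRsq R⁸/2⁶ + Ns_b/2^217)·P₄/2^13`, `ZA_c` likewise (`P₄ = 1696963596321 + 925·10¹⁴(1+Gfr₃+Gfr₄)`, `l = 4^{n_β}`,
`l² ≤ β²/2^13`).  NEW inputs: `{P} (hL : klEngL₄ P R β U ≤ L)` (the REGISTERED volume door of rev 14), `hs : 10 ≤ s`, and GRADED ENVELOPES of the moments
`hNm_X : ∀ j ≤ 4, Mm_X j ≤ Nm_X·lʲ`, `hNs_X : Ms_X ≤ Ns_X` (`X = b, c`; any currency — `Nm, Ns` enter `C` linearly).  REMAINING ASKS of #20 (δ′) after this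
file (by name): `hZn` (analyticity lane); the moments `Mm_b/Ms_b`, `Mm_c/Ms_c` with their envelopes `Nm/Ns` and the Bell rows `PP_b, PP_c` + sizes `Zb, Zc`
(E1 / class-#7 TIME row); the smallness rows `hZt/hZtU/hCU` (U-threshold; `klLastRespU` margin = trigger (i) of the p2 queue, now with `ZA_X` explicit).

* **`lastResponse_bracket_flow_sharp_alias`**.

Composition only; no definitions; nothing asserts superconductivity.  Refs: BGM 2006 §2.2 (2.23), §2.3 (2.21)–(2.24), §2.4 Lemma 2.1 (2.36)–(2.42), §3 (3.2)
[cite: BenfattoGiulianiMastropietro2006]; FST 1996 §1 [cite: FeldmanSalmhoferTrubowitz1996].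
-/

noncomputable section

namespace Summit.HubbardSuperconductivity.HubbardSuperconductivity.Theorems.EngineV8

set_option linter.dupNamespace false -- summit = problem name (single-conjunct summit), D-0017

open Complex Real Finset Filter Literature.MathematicalPhysics.QuantumLattice Literature.Probability.LatticeModels
open Literature.MathematicalPhysics.QuantumLattice.BandSectorCounting
open Literature.Analysis.Fourier Literature.Analysis.Calculus
open Summit.HubbardSuperconductivity.HubbardSuperconductivity.Theorems.KLRegimeSplit
open Summit.HubbardSuperconductivity.HubbardSuperconductivity.Theorems.DispersionFlow
open Summit.HubbardSuperconductivity.HubbardSuperconductivity.Theorems.KLProgrammeLegKernels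
open Summit.HubbardSuperconductivity.HubbardSuperconductivity.Theorems.PerturbedFermiCurve
open scoped Nat

section FlowSharpAlias

variable {L M : ℕ} [NeZero L] [NeZero M]

set_option maxHeartbeats 400000 in -- heartbeat disclosure (R137): ≈ 100-binder statement + one 70-argument composition with six explicit function instantiations; whnf-times-out at 200k, 400k passes (≈ 20 s)
/-- **THE RESPONSE BRACKET AT THE FLOW FRAMES, SHARP, SYMBOL SUPS AND ALIAS ROWS DISCHARGED** — see the module docstring.  Output = `(hRdiff, hR)` of
`twoLegReadPriv_flow_succ_of_swap_lit` at `n = nScales β` with `eR = fun k => if k = 0 then 0 else 1`, `eR' = fun k => if k = 0 then 1 else 0`. -/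
theorem lastResponse_bracket_flow_sharp_alias {R : RenConsts} (hR : ∀ j, 0 ≤ R.Gfr j) {c : ℝ} (hc : 0 < c) (hcle : c ≤ klCurveC3 R)
    {U : ℝ} (hU : 0 < U) (hU1 : U ≤ 1) (hUle : U ≤ klCurveU0 R) {β : ℝ} (hβmin : klBetaMin ≤ β) (hβc : β ≤ Real.exp (c / U ^ 2))
    {μ : ℝ} (hμ : μ ∈ klWindowC) (hK : FrameOK R U (nScales β) μ (klFlowFrameU L M β U μ (nScales β))) {G : GeoConsts} {Q : EngConsts} (hGS : ∀ k, 0 ≤ G.S k) (hQS : ∀ k, 0 ≤ Q.S' k) (hR0 : 0 < R.Gfr 0)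
    (hPh : ∀ m ≤ nScales β, FlowPieceJetsAt L M β U μ R m) (hT : ∀ m ≤ nScales β, TwoLegReadJetsF L M G Q β U μ m) {W Ξ Θ : ℝ}
    (hW : W = curveExtC (klChi2CauchyTab2 4) G.S 1 + curveExtC (klChi2CauchyTab2 4) Q.S' 1 * |U|) (hΞ : Ξ = 2 ^ 10 * (1 + Real.pi ^ 8 * (W * U ^ 2) / 2 ^ 11) + ∑ j ∈ range 5, R.Gfr j)
    (hΘ : Θ = 1 + ((∑ j ∈ range 5, R.Gfr j) + Real.pi ^ 8 * W / 2 ^ 11) * |U| / R.Gfr 0)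
    (hdoor : R.Gfr 0 * |U| + ((∑ j ∈ range 5, R.Gfr j) + Real.pi ^ 8 * W / 2 ^ 11) * U ^ 2 ≤ 1 / 512) {P : SplitConsts} (hL : klEngL₄ P R β U ≤ L)
    (hZn : IsUnit (effPartitionFn ℂ (normalCovariance L M (uvSymbolCT L M β μ (klFlowFrameU L M β U μ (nScales β + 1)) (klScale klE0 (nScales β + 1))))
      (hubbardInteraction L M β U + counterQuadratic L M β (klFlowFrameU L M β U μ (nScales β + 1)))))
    {Zt Zb Zc Nmb Nsb Nmc Nsc : ℝ} (hZt : 128 * (R.Gfr 0 + R.Gfr 1 + R.Gfr 2 + R.Gfr 3 + R.Gfr 4) * (1696963596321 + 925 * (10 ^ 14 * (1 + R.Gfr 3 + R.Gfr 4))) ≤ Zt) (hZtU : 2 * Zt * U ≤ 1)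
    (hCU : 16 * (2 ^ 29 * (1 / 32) * Zt ^ 3 * (1696963596321 + 925 * (10 ^ 14 * (1 + R.Gfr 3 + R.Gfr 4))) + 2 ^ 38 * Zt ^ 2 * Zb + 2 ^ 33 * Zt * Zc + (klEngRsq R ^ 8 * (1696963596321 + 925 * (10 ^ 14 * (1 + R.Gfr 3 + R.Gfr 4))) / 2 ^ 30 + (Nmb * klEngRsq R ^ 8 / 2 ^ 6 + Nsb / 2 ^ 217) * (1696963596321 + 925 * (10 ^ 14 * (1 + R.Gfr 3 + R.Gfr 4))) / 2 ^ 13 +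
      (Nmc * klEngRsq R ^ 8 / 2 ^ 6 + Nsc / 2 ^ 217) * (1696963596321 + 925 * (10 ^ 14 * (1 + R.Gfr 3 + R.Gfr 4))) / 2 ^ 13)) * U ≤ 1)
    {s : ℕ} (hs : 10 ≤ s)
    {Mmb : ℕ → ℝ} (hMmb : ∀ m ≤ 4, ∑ x : TorusSite 2 L, (1 + ((x 0).valMinAbs.natAbs : ℝ) + ((x 1).valMinAbs.natAbs : ℝ)) ^ m *
      ‖torusFourierInv (fun k => ((((fun k : TorusSite 2 L => klLocSelfEnergyRe L M β U μ (klFlowFrameU L M β U μ (nScales β + 1)) (nScales β + 1) k) k : ℝ)) : ℂ)) x‖ ≤ Mmb m)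
    {Msb : ℝ} (hMsb : ∑ x : TorusSite 2 L, (1 + ((x 0).valMinAbs.natAbs : ℝ) + ((x 1).valMinAbs.natAbs : ℝ)) ^ s *
      ‖torusFourierInv (fun k => ((((fun k : TorusSite 2 L => klLocSelfEnergyRe L M β U μ (klFlowFrameU L M β U μ (nScales β + 1)) (nScales β + 1) k) k : ℝ)) : ℂ)) x‖ ≤ Msb)
    {Mmc : ℕ → ℝ} (hMmc : ∀ m ≤ 4, ∑ x : TorusSite 2 L, (1 + ((x 0).valMinAbs.natAbs : ℝ) + ((x 1).valMinAbs.natAbs : ℝ)) ^ m *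
      ‖torusFourierInv (fun k => ((((fun k : TorusSite 2 L => (∑ s : Fin 2, ((klSelfEnergy L M β U μ (klFlowFrameU L M β U μ (nScales β + 1)) klE0 (nScales β + 1) (omega0 M, k) s).im -
          (klSelfEnergy L M β U μ (klFlowFrameU L M β U μ (nScales β + 1)) klE0 (nScales β + 1) ((omega0 M).rev, k) s).im)) / 4) k : ℝ)) : ℂ)) x‖ ≤ Mmc m)
    {Msc : ℝ} (hMsc : ∑ x : TorusSite 2 L, (1 + ((x 0).valMinAbs.natAbs : ℝ) + ((x 1).valMinAbs.natAbs : ℝ)) ^ s *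
      ‖torusFourierInv (fun k => ((((fun k : TorusSite 2 L => (∑ s : Fin 2, ((klSelfEnergy L M β U μ (klFlowFrameU L M β U μ (nScales β + 1)) klE0 (nScales β + 1) (omega0 M, k) s).im -
          (klSelfEnergy L M β U μ (klFlowFrameU L M β U μ (nScales β + 1)) klE0 (nScales β + 1) ((omega0 M).rev, k) s).im)) / 4) k : ℝ)) : ℂ)) x‖ ≤ Msc)
    {PPb : ℕ → ℝ} (hPPb0 : Mmb 0 ≤ PPb 0) (hPPb1 : Mmb 1 * klCurveD1 ≤ PPb 1) (hPPb2 : Mmb 2 * klCurveD1 ^ 2 + Mmb 1 * klCurveD2 ≤ PPb 2)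
    (hPPb3 : Mmb 3 * klCurveD1 ^ 3 + 3 * Mmb 2 * klCurveD1 * klCurveD2 + Mmb 1 * (klCurveD3 (R.Gfr 3 * U ^ 2 * ((4 : ℝ) ^ (nScales β + 1) / 3))) ≤ PPb 3)
    (hPPb4 : Mmb 4 * klCurveD1 ^ 4 + 6 * Mmb 3 * klCurveD1 ^ 2 * klCurveD2 + 3 * Mmb 2 * klCurveD2 ^ 2 + 4 * Mmb 2 * klCurveD1 * (klCurveD3 (R.Gfr 3 * U ^ 2 * ((4 : ℝ) ^ (nScales β +
        1) / 3))) + Mmb 1 * (klCurveD4 (R.Gfr 3 * U ^ 2 * ((4 : ℝ) ^ (nScales β + 1) / 3)) (R.Gfr 4 * U ^ 2 * ((16 : ℝ) ^ (nScales β + 1) / 15))) ≤ PPb 4)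
    {PPc : ℕ → ℝ} (hPPc0 : Mmc 0 ≤ PPc 0) (hPPc1 : Mmc 1 * klCurveD1 ≤ PPc 1) (hPPc2 : Mmc 2 * klCurveD1 ^ 2 + Mmc 1 * klCurveD2 ≤ PPc 2)
    (hPPc3 : Mmc 3 * klCurveD1 ^ 3 + 3 * Mmc 2 * klCurveD1 * klCurveD2 + Mmc 1 * (klCurveD3 (R.Gfr 3 * U ^ 2 * ((4 : ℝ) ^ (nScales β + 1) / 3))) ≤ PPc 3)
    (hPPc4 : Mmc 4 * klCurveD1 ^ 4 + 6 * Mmc 3 * klCurveD1 ^ 2 * klCurveD2 + 3 * Mmc 2 * klCurveD2 ^ 2 + 4 * Mmc 2 * klCurveD1 * (klCurveD3 (R.Gfr 3 * U ^ 2 * ((4 : ℝ) ^ (nScales β +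
        1) / 3))) + Mmc 1 * (klCurveD4 (R.Gfr 3 * U ^ 2 * ((4 : ℝ) ^ (nScales β + 1) / 3)) (R.Gfr 4 * U ^ 2 * ((16 : ℝ) ^ (nScales β + 1) / 15))) ≤ PPc 4)
    (hPPbs : ∀ j ≤ 4, PPb j ≤ Zb * U * ((4 : ℝ) ^ nScales β) ^ j)
    (hPPcs : ∀ j ≤ 4, PPc j ≤ Zc * U ^ 2 * ((4 : ℝ) ^ nScales β) ^ j / ((4 : ℝ) ^ nScales β))
    (hNmb : ∀ j ≤ 4, Mmb j ≤ Nmb * ((4 : ℝ) ^ nScales β) ^ j) (hNsb : Msb ≤ Nsb) (hNmc : ∀ j ≤ 4, Mmc j ≤ Nmc * ((4 : ℝ) ^ nScales β) ^ j) (hNsc : Msc ≤ Nsc) :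
    ContDiff ℝ 4 (fun θ : ℝ => (symInterp L (fun k => klLocSelfEnergyRe L M β U μ (klFlowFrameU L M β U μ (nScales β + 1)) (nScales β + 1) k -
            (klFlowFrameU L M β U μ (nScales β + 1)).eval (latticeMomentum L k))).eval (klFermiPoint μ (klFlowFrameU L M β U μ (nScales β)) θ) -
        (symInterp L (fun k => klLocSelfEnergyRe L M β U μ (klFlowFrameU L M β U μ (nScales β)) (nScales β + 1) k -
            (klFlowFrameU L M β U μ (nScales β)).eval (latticeMomentum L k))).eval (klFermiPoint μ (klFlowFrameU L M β U μ (nScales β)) θ)) ∧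
    ∀ k ≤ 4, ∀ θ : ℝ, |iteratedDeriv k (fun θ : ℝ => (symInterp L (fun k => klLocSelfEnergyRe L M β U μ (klFlowFrameU L M β U μ (nScales β + 1)) (nScales β + 1) k -
            (klFlowFrameU L M β U μ (nScales β + 1)).eval (latticeMomentum L k))).eval (klFermiPoint μ (klFlowFrameU L M β U μ (nScales β)) θ) -
        (symInterp L (fun k => klLocSelfEnergyRe L M β U μ (klFlowFrameU L M β U μ (nScales β)) (nScales β + 1) k -
            (klFlowFrameU L M β U μ (nScales β)).eval (latticeMomentum L k))).eval (klFermiPoint μ (klFlowFrameU L M β U μ (nScales β)) θ)) θ| ≤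
      curveJetBar (fun k => if k = 0 then 0 else 1) (fun k => if k = 0 then 1 else 0) U k (nScales β + 1) := by
  have h128 : (128 : ℝ) ≤ β := by simpa [klBetaMin] using hβmin
  have hβ0 : (0 : ℝ) < β := by linarith
  have hX40 : (0 : ℝ) ≤ klChi2CauchyTab2 4 := by norm_num [klChi2CauchyTab2]
  have hW0 : 0 ≤ W := by
    rw [hW]; have h1 := curveExtC_nonneg hX40 hGS 1; have h2 := curveExtC_nonneg hX40 hQS 1; positivity
  have hl1 : (1 : ℝ) ≤ ((4 : ℝ) ^ nScales β) := one_le_pow₀ (by norm_num)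
  have hl0 : (0 : ℝ) < ((4 : ℝ) ^ nScales β) := by positivity
  have hRsq8 : (0 : ℝ) ≤ klEngRsq R ^ 8 := pow_nonneg (klEngRsq_pos R).le 8
  have hV0 : (0 : ℝ) ≤ (U ^ 3 / β ^ 2) := div_nonneg (pow_nonneg hU.le 3) (sq_nonneg β)
  -- the moments are nonnegative (they dominate sums of nonnegative terms)
  have hMmb0 : ∀ m ≤ 4, 0 ≤ Mmb m := fun m hm => le_trans (Finset.sum_nonneg fun x _ => by positivity) (hMmb m hm)
  have hMsb0 : 0 ≤ Msb := le_trans (Finset.sum_nonneg fun x _ => by positivity) hMsb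
  have hMmc0 : ∀ m ≤ 4, 0 ≤ Mmc m := fun m hm => le_trans (Finset.sum_nonneg fun x _ => by positivity) (hMmc m hm)
  have hMsc0 : 0 ≤ Msc := le_trans (Finset.sum_nonneg fun x _ => by positivity) hMsc
  have hNmb0 : 0 ≤ Nmb := by have h := hNmb 0 (by norm_num); rw [pow_zero, mul_one] at h; exact (hMmb0 0 (by norm_num)).trans h
  have hNmc0 : 0 ≤ Nmc := by have h := hNmc 0 (by norm_num); rw [pow_zero, mul_one] at h; exact (hMmc0 0 (by norm_num)).trans h
  have hNsb0 : 0 ≤ Nsb := hMsb0.trans hNsb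
  have hNsc0 : 0 ≤ Nsc := hMsc0.trans hNsc
  have hcA0 : (0 : ℝ) ≤ klEngRsq R ^ 8 / 2 ^ 17 * (U ^ 3 / β ^ 2) := mul_nonneg (div_nonneg hRsq8 (by norm_num)) hV0
  have hcB0 : (0 : ℝ) ≤ (Nmb * klEngRsq R ^ 8 / 2 ^ 6 + Nsb / 2 ^ 217) * (U ^ 3 / β ^ 2) := mul_nonneg (add_nonneg (div_nonneg (mul_nonneg hNmb0 hRsq8) (by norm_num)) (div_nonneg hNsb0 (by norm_num))) hV0
  have hcC0 : (0 : ℝ) ≤ (Nmc * klEngRsq R ^ 8 / 2 ^ 6 + Nsc / 2 ^ 217) * (U ^ 3 / β ^ 2) := mul_nonneg (add_nonneg (div_nonneg (mul_nonneg hNmc0 hRsq8) (by norm_num)) (div_nonneg hNsc0 (by norm_num))) hV0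
  have cAconv : klEngRsq R ^ 8 * U ^ 3 / (2 ^ 17 * β ^ 2) = klEngRsq R ^ 8 / 2 ^ 17 * (U ^ 3 / β ^ 2) := by
    rw [div_mul_div_comm]
  -- the graded rows of the three channels (…LastStepAliasRows + graded envelopes)
  have rowA : ∀ j ≤ 4, 2 * (2 * (1 * ((3 : ℝ) ^ j * (((R.Gfr 0 * |U| * Θ * ((16 : ℝ) ^ nScales β)⁻¹) * (R.Gfr 0 * |U| * Θ * ((16 : ℝ) ^ nScales β)⁻¹) / |(β * (L : ℝ) ^ 2)|) * ((5 : ℝ) * (|(β * (L : ℝ)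
      ^ 2)| * (6 / (klScale klE0 (nScales β + 1))))) * ((26 ! : ℝ)) ^ 2 * (2 * (2 * (2 ^ 10 * (1 : ℝ) * (4 : ℝ) ^ nScales β) + 2 * (4 * (2 * (4 * (4 + (4 : ℝ) ^ nScales β * Ξ) * (1 +
      16 * (1 + (27 / 10 : ℝ)) / (klScale klE0 (nScales β + 1)) * 1) + (2 ^ 10 * (1 : ℝ) * (4 : ℝ) ^ nScales β))) * (1 + 6 / (klScale klE0 (nScales β + 1)) * ((klScale klE0 (nScales β
      + 1)) / 128 + (5 : ℝ) * (R.Gfr 0 * |U| * Θ * ((16 : ℝ) ^ nScales β)⁻¹)))))) ^ 26) * (2 / ((2 * (L / 4 + 1) : ℕ) : ℝ)) ^ (26 - j - 4) * (2 ^ 2 * ∑' k : Fin 2 → ℤ, ∏ i, (1 + (k i :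
      ℝ) ^ 2)⁻¹)))) + (L : ℝ) ^ 2 * (L : ℝ) ^ j * ((((R.Gfr 0 * |U| * Θ * ((16 : ℝ) ^ nScales β)⁻¹) * (R.Gfr 0 * |U| * Θ * ((16 : ℝ) ^ nScales β)⁻¹) / |(β * (L : ℝ) ^ 2)|) * ((5 : ℝ) *
      (|(β * (L : ℝ) ^ 2)| * (6 / (klScale klE0 (nScales β + 1))))) * ((0 ! : ℝ)) ^ 2 * (2 * (2 * (2 ^ 10 * (1 : ℝ) * (4 : ℝ) ^ nScales β) + 2 * (4 * (2 * (4 * (4 + (4 : ℝ) ^ nScales β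
      * Ξ) * (1 + 16 * (1 + (27 / 10 : ℝ)) / (klScale klE0 (nScales β + 1)) * 1) + (2 ^ 10 * (1 : ℝ) * (4 : ℝ) ^ nScales β))) * (1 + 6 / (klScale klE0 (nScales β + 1)) * ((klScale klE0
      (nScales β + 1)) / 128 + (5 : ℝ) * (R.Gfr 0 * |U| * Θ * ((16 : ℝ) ^ nScales β)⁻¹)))))) ^ 0) * (1 / (1 + (L : ℝ) / 4) ^ s)) ≤ klEngRsq R ^ 8 / 2 ^ 17 * (U ^ 3 / β ^ 2) * ((4 : ℝ) ^ nScales β) ^ j := fun j hj => by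
    have h := lastAliasRowA_le (P := P) hR hR0 hW0 hβmin hU hU1 hΞ hΘ hdoor hL hs hj
    rw [cAconv] at h
    exact h.trans (le_mul_of_one_le_right hcA0 (one_le_pow₀ hl1))
  have rowA0 : ∀ j ≤ 4, 0 ≤ 2 * (2 * (1 * ((3 : ℝ) ^ j * (((R.Gfr 0 * |U| * Θ * ((16 : ℝ) ^ nScales β)⁻¹) * (R.Gfr 0 * |U| * Θ * ((16 : ℝ) ^ nScales β)⁻¹) / |(β * (L : ℝ) ^ 2)|) * ((5 : ℝ) * (|(β * (L : ℝ)
      ^ 2)| * (6 / (klScale klE0 (nScales β + 1))))) * ((26 ! : ℝ)) ^ 2 * (2 * (2 * (2 ^ 10 * (1 : ℝ) * (4 : ℝ) ^ nScales β) + 2 * (4 * (2 * (4 * (4 + (4 : ℝ) ^ nScales β * Ξ) * (1 +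
      16 * (1 + (27 / 10 : ℝ)) / (klScale klE0 (nScales β + 1)) * 1) + (2 ^ 10 * (1 : ℝ) * (4 : ℝ) ^ nScales β))) * (1 + 6 / (klScale klE0 (nScales β + 1)) * ((klScale klE0 (nScales β
      + 1)) / 128 + (5 : ℝ) * (R.Gfr 0 * |U| * Θ * ((16 : ℝ) ^ nScales β)⁻¹)))))) ^ 26) * (2 / ((2 * (L / 4 + 1) : ℕ) : ℝ)) ^ (26 - j - 4) * (2 ^ 2 * ∑' k : Fin 2 → ℤ, ∏ i, (1 + (k i :
      ℝ) ^ 2)⁻¹)))) + (L : ℝ) ^ 2 * (L : ℝ) ^ j * ((((R.Gfr 0 * |U| * Θ * ((16 : ℝ) ^ nScales β)⁻¹) * (R.Gfr 0 * |U| * Θ * ((16 : ℝ) ^ nScales β)⁻¹) / |(β * (L : ℝ) ^ 2)|) * ((5 : ℝ) *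
      (|(β * (L : ℝ) ^ 2)| * (6 / (klScale klE0 (nScales β + 1))))) * ((0 ! : ℝ)) ^ 2 * (2 * (2 * (2 ^ 10 * (1 : ℝ) * (4 : ℝ) ^ nScales β) + 2 * (4 * (2 * (4 * (4 + (4 : ℝ) ^ nScales β
      * Ξ) * (1 + 16 * (1 + (27 / 10 : ℝ)) / (klScale klE0 (nScales β + 1)) * 1) + (2 ^ 10 * (1 : ℝ) * (4 : ℝ) ^ nScales β))) * (1 + 6 / (klScale klE0 (nScales β + 1)) * ((klScale klE0
      (nScales β + 1)) / 128 + (5 : ℝ) * (R.Gfr 0 * |U| * Θ * ((16 : ℝ) ^ nScales β)⁻¹)))))) ^ 0) * (1 / (1 + (L : ℝ) / 4) ^ s)) := fun j _ =>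
    lastAliasRowA_nonneg hR hR0 hW0 hβmin hΞ hΘ hdoor (s := s) (j := j)
  have rowB : ∀ j ≤ 4, 2 * (2 * (Mmb j * ((3 : ℝ) ^ j * (((R.Gfr 0 * |U| * Θ * ((16 : ℝ) ^ nScales β)⁻¹) / |(β * (L : ℝ) ^ 2)| * ((5 : ℝ) * (|(β * (L : ℝ) ^ 2)| * (6 / (klScale klE0 (nScales β +
      1)))))) * ((R.Gfr 0 * |U| * Θ * ((16 : ℝ) ^ nScales β)⁻¹) / |(β * (L : ℝ) ^ 2)| * ((5 : ℝ) * (|(β * (L : ℝ) ^ 2)| * (6 / (klScale klE0 (nScales β + 1)))))) * ((26 ! : ℝ)) ^ 2 *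
      (2 * (2 * (2 * (2 ^ 10 * (1 : ℝ) * (4 : ℝ) ^ nScales β) + 2 * (4 * (2 * (4 * (4 + (4 : ℝ) ^ nScales β * Ξ) * (1 + 16 * (1 + (27 / 10 : ℝ)) / (klScale klE0 (nScales β + 1)) * 1) +
      (2 ^ 10 * (1 : ℝ) * (4 : ℝ) ^ nScales β))) * (1 + 6 / (klScale klE0 (nScales β + 1)) * ((klScale klE0 (nScales β + 1)) / 128 + (5 : ℝ) * (R.Gfr 0 * |U| * Θ * ((16 : ℝ) ^ nScales
      β)⁻¹))))))) ^ 26 + 2 * (((R.Gfr 0 * |U| * Θ * ((16 : ℝ) ^ nScales β)⁻¹) / |(β * (L : ℝ) ^ 2)|) * ((5 : ℝ) * (|(β * (L : ℝ) ^ 2)| * (6 / (klScale klE0 (nScales β + 1))))) * ((26 !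
      : ℝ)) ^ 2 * (2 * (2 * (2 ^ 10 * (1 : ℝ) * (4 : ℝ) ^ nScales β) + 2 * (4 * (2 * (4 * (4 + (4 : ℝ) ^ nScales β * Ξ) * (1 + 16 * (1 + (27 / 10 : ℝ)) / (klScale klE0 (nScales β + 1))
      * 1) + (2 ^ 10 * (1 : ℝ) * (4 : ℝ) ^ nScales β))) * (1 + 6 / (klScale klE0 (nScales β + 1)) * ((klScale klE0 (nScales β + 1)) / 128 + (5 : ℝ) * (R.Gfr 0 * |U| * Θ * ((16 : ℝ) ^
      nScales β)⁻¹)))))) ^ 26)) * (2 / ((2 * (L / 4 + 1) : ℕ) : ℝ)) ^ (26 - j - 4) * (2 ^ 2 * ∑' k : Fin 2 → ℤ, ∏ i, (1 + (k i : ℝ) ^ 2)⁻¹)))) + (L : ℝ) ^ 2 * (L : ℝ) ^ j * ((((R.Gfr 0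
      * |U| * Θ * ((16 : ℝ) ^ nScales β)⁻¹) / |(β * (L : ℝ) ^ 2)| * ((5 : ℝ) * (|(β * (L : ℝ) ^ 2)| * (6 / (klScale klE0 (nScales β + 1)))))) * ((R.Gfr 0 * |U| * Θ * ((16 : ℝ) ^
      nScales β)⁻¹) / |(β * (L : ℝ) ^ 2)| * ((5 : ℝ) * (|(β * (L : ℝ) ^ 2)| * (6 / (klScale klE0 (nScales β + 1)))))) * ((0 ! : ℝ)) ^ 2 * (2 * (2 * (2 * (2 ^ 10 * (1 : ℝ) * (4 : ℝ) ^
      nScales β) + 2 * (4 * (2 * (4 * (4 + (4 : ℝ) ^ nScales β * Ξ) * (1 + 16 * (1 + (27 / 10 : ℝ)) / (klScale klE0 (nScales β + 1)) * 1) + (2 ^ 10 * (1 : ℝ) * (4 : ℝ) ^ nScales β))) *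
      (1 + 6 / (klScale klE0 (nScales β + 1)) * ((klScale klE0 (nScales β + 1)) / 128 + (5 : ℝ) * (R.Gfr 0 * |U| * Θ * ((16 : ℝ) ^ nScales β)⁻¹))))))) ^ 0 + 2 * (((R.Gfr 0 * |U| * Θ *
      ((16 : ℝ) ^ nScales β)⁻¹) / |(β * (L : ℝ) ^ 2)|) * ((5 : ℝ) * (|(β * (L : ℝ) ^ 2)| * (6 / (klScale klE0 (nScales β + 1))))) * ((0 ! : ℝ)) ^ 2 * (2 * (2 * (2 ^ 10 * (1 : ℝ) * (4 :
      ℝ) ^ nScales β) + 2 * (4 * (2 * (4 * (4 + (4 : ℝ) ^ nScales β * Ξ) * (1 + 16 * (1 + (27 / 10 : ℝ)) / (klScale klE0 (nScales β + 1)) * 1) + (2 ^ 10 * (1 : ℝ) * (4 : ℝ) ^ nScales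
      β))) * (1 + 6 / (klScale klE0 (nScales β + 1)) * ((klScale klE0 (nScales β + 1)) / 128 + (5 : ℝ) * (R.Gfr 0 * |U| * Θ * ((16 : ℝ) ^ nScales β)⁻¹)))))) ^ 0)) * (Msb / (1 + (L : ℝ)
      / 4) ^ s)) ≤ (Nmb * klEngRsq R ^ 8 / 2 ^ 6 + Nsb / 2 ^ 217) * (U ^ 3 / β ^ 2) * ((4 : ℝ) ^ nScales β) ^ j := fun j hj =>
    (lastAliasRowB_le (P := P) hR hR0 hW0 hβmin hU hU1 hΞ hΘ hdoor hL hs hj (hMmb0 j hj) hMsb0).trans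
      (graded_envelope_le hU.le hU1 h128 hl1 (hMmb0 j hj) hMsb0 (hNmb j hj) hNsb)
  have rowB0 : ∀ j ≤ 4, 0 ≤ 2 * (2 * (Mmb j * ((3 : ℝ) ^ j * (((R.Gfr 0 * |U| * Θ * ((16 : ℝ) ^ nScales β)⁻¹) / |(β * (L : ℝ) ^ 2)| * ((5 : ℝ) * (|(β * (L : ℝ) ^ 2)| * (6 / (klScale klE0 (nScales β +
      1)))))) * ((R.Gfr 0 * |U| * Θ * ((16 : ℝ) ^ nScales β)⁻¹) / |(β * (L : ℝ) ^ 2)| * ((5 : ℝ) * (|(β * (L : ℝ) ^ 2)| * (6 / (klScale klE0 (nScales β + 1)))))) * ((26 ! : ℝ)) ^ 2 *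
      (2 * (2 * (2 * (2 ^ 10 * (1 : ℝ) * (4 : ℝ) ^ nScales β) + 2 * (4 * (2 * (4 * (4 + (4 : ℝ) ^ nScales β * Ξ) * (1 + 16 * (1 + (27 / 10 : ℝ)) / (klScale klE0 (nScales β + 1)) * 1) +
      (2 ^ 10 * (1 : ℝ) * (4 : ℝ) ^ nScales β))) * (1 + 6 / (klScale klE0 (nScales β + 1)) * ((klScale klE0 (nScales β + 1)) / 128 + (5 : ℝ) * (R.Gfr 0 * |U| * Θ * ((16 : ℝ) ^ nScales
      β)⁻¹))))))) ^ 26 + 2 * (((R.Gfr 0 * |U| * Θ * ((16 : ℝ) ^ nScales β)⁻¹) / |(β * (L : ℝ) ^ 2)|) * ((5 : ℝ) * (|(β * (L : ℝ) ^ 2)| * (6 / (klScale klE0 (nScales β + 1))))) * ((26 !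
      : ℝ)) ^ 2 * (2 * (2 * (2 ^ 10 * (1 : ℝ) * (4 : ℝ) ^ nScales β) + 2 * (4 * (2 * (4 * (4 + (4 : ℝ) ^ nScales β * Ξ) * (1 + 16 * (1 + (27 / 10 : ℝ)) / (klScale klE0 (nScales β + 1))
      * 1) + (2 ^ 10 * (1 : ℝ) * (4 : ℝ) ^ nScales β))) * (1 + 6 / (klScale klE0 (nScales β + 1)) * ((klScale klE0 (nScales β + 1)) / 128 + (5 : ℝ) * (R.Gfr 0 * |U| * Θ * ((16 : ℝ) ^
      nScales β)⁻¹)))))) ^ 26)) * (2 / ((2 * (L / 4 + 1) : ℕ) : ℝ)) ^ (26 - j - 4) * (2 ^ 2 * ∑' k : Fin 2 → ℤ, ∏ i, (1 + (k i : ℝ) ^ 2)⁻¹)))) + (L : ℝ) ^ 2 * (L : ℝ) ^ j * ((((R.Gfr 0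
      * |U| * Θ * ((16 : ℝ) ^ nScales β)⁻¹) / |(β * (L : ℝ) ^ 2)| * ((5 : ℝ) * (|(β * (L : ℝ) ^ 2)| * (6 / (klScale klE0 (nScales β + 1)))))) * ((R.Gfr 0 * |U| * Θ * ((16 : ℝ) ^
      nScales β)⁻¹) / |(β * (L : ℝ) ^ 2)| * ((5 : ℝ) * (|(β * (L : ℝ) ^ 2)| * (6 / (klScale klE0 (nScales β + 1)))))) * ((0 ! : ℝ)) ^ 2 * (2 * (2 * (2 * (2 ^ 10 * (1 : ℝ) * (4 : ℝ) ^
      nScales β) + 2 * (4 * (2 * (4 * (4 + (4 : ℝ) ^ nScales β * Ξ) * (1 + 16 * (1 + (27 / 10 : ℝ)) / (klScale klE0 (nScales β + 1)) * 1) + (2 ^ 10 * (1 : ℝ) * (4 : ℝ) ^ nScales β))) *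
      (1 + 6 / (klScale klE0 (nScales β + 1)) * ((klScale klE0 (nScales β + 1)) / 128 + (5 : ℝ) * (R.Gfr 0 * |U| * Θ * ((16 : ℝ) ^ nScales β)⁻¹))))))) ^ 0 + 2 * (((R.Gfr 0 * |U| * Θ *
      ((16 : ℝ) ^ nScales β)⁻¹) / |(β * (L : ℝ) ^ 2)|) * ((5 : ℝ) * (|(β * (L : ℝ) ^ 2)| * (6 / (klScale klE0 (nScales β + 1))))) * ((0 ! : ℝ)) ^ 2 * (2 * (2 * (2 ^ 10 * (1 : ℝ) * (4 :
      ℝ) ^ nScales β) + 2 * (4 * (2 * (4 * (4 + (4 : ℝ) ^ nScales β * Ξ) * (1 + 16 * (1 + (27 / 10 : ℝ)) / (klScale klE0 (nScales β + 1)) * 1) + (2 ^ 10 * (1 : ℝ) * (4 : ℝ) ^ nScales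
      β))) * (1 + 6 / (klScale klE0 (nScales β + 1)) * ((klScale klE0 (nScales β + 1)) / 128 + (5 : ℝ) * (R.Gfr 0 * |U| * Θ * ((16 : ℝ) ^ nScales β)⁻¹)))))) ^ 0)) * (Msb / (1 + (L : ℝ)
      / 4) ^ s)) := fun j hj =>
    lastAliasRowB_nonneg hR hR0 hW0 hβmin hΞ hΘ hdoor (s := s) (j := j) (hMmb0 j hj) hMsb0
  have rowC : ∀ j ≤ 4, 2 * (2 * (Mmc j * ((3 : ℝ) ^ j * (((R.Gfr 0 * |U| * Θ * ((16 : ℝ) ^ nScales β)⁻¹) / |(β * (L : ℝ) ^ 2)| * ((5 : ℝ) * (|(β * (L : ℝ) ^ 2)| * (6 / (klScale klE0 (nScales β +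
      1)))))) * ((R.Gfr 0 * |U| * Θ * ((16 : ℝ) ^ nScales β)⁻¹) / |(β * (L : ℝ) ^ 2)| * ((5 : ℝ) * (|(β * (L : ℝ) ^ 2)| * (6 / (klScale klE0 (nScales β + 1)))))) * ((26 ! : ℝ)) ^ 2 *
      (2 * (2 * (2 * (2 ^ 10 * (1 : ℝ) * (4 : ℝ) ^ nScales β) + 2 * (4 * (2 * (4 * (4 + (4 : ℝ) ^ nScales β * Ξ) * (1 + 16 * (1 + (27 / 10 : ℝ)) / (klScale klE0 (nScales β + 1)) * 1) +
      (2 ^ 10 * (1 : ℝ) * (4 : ℝ) ^ nScales β))) * (1 + 6 / (klScale klE0 (nScales β + 1)) * ((klScale klE0 (nScales β + 1)) / 128 + (5 : ℝ) * (R.Gfr 0 * |U| * Θ * ((16 : ℝ) ^ nScales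
      β)⁻¹))))))) ^ 26 + 2 * (((R.Gfr 0 * |U| * Θ * ((16 : ℝ) ^ nScales β)⁻¹) / |(β * (L : ℝ) ^ 2)|) * ((5 : ℝ) * (|(β * (L : ℝ) ^ 2)| * (6 / (klScale klE0 (nScales β + 1))))) * ((26 !
      : ℝ)) ^ 2 * (2 * (2 * (2 ^ 10 * (1 : ℝ) * (4 : ℝ) ^ nScales β) + 2 * (4 * (2 * (4 * (4 + (4 : ℝ) ^ nScales β * Ξ) * (1 + 16 * (1 + (27 / 10 : ℝ)) / (klScale klE0 (nScales β + 1))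
      * 1) + (2 ^ 10 * (1 : ℝ) * (4 : ℝ) ^ nScales β))) * (1 + 6 / (klScale klE0 (nScales β + 1)) * ((klScale klE0 (nScales β + 1)) / 128 + (5 : ℝ) * (R.Gfr 0 * |U| * Θ * ((16 : ℝ) ^
      nScales β)⁻¹)))))) ^ 26)) * (2 / ((2 * (L / 4 + 1) : ℕ) : ℝ)) ^ (26 - j - 4) * (2 ^ 2 * ∑' k : Fin 2 → ℤ, ∏ i, (1 + (k i : ℝ) ^ 2)⁻¹)))) + (L : ℝ) ^ 2 * (L : ℝ) ^ j * ((((R.Gfr 0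
      * |U| * Θ * ((16 : ℝ) ^ nScales β)⁻¹) / |(β * (L : ℝ) ^ 2)| * ((5 : ℝ) * (|(β * (L : ℝ) ^ 2)| * (6 / (klScale klE0 (nScales β + 1)))))) * ((R.Gfr 0 * |U| * Θ * ((16 : ℝ) ^
      nScales β)⁻¹) / |(β * (L : ℝ) ^ 2)| * ((5 : ℝ) * (|(β * (L : ℝ) ^ 2)| * (6 / (klScale klE0 (nScales β + 1)))))) * ((0 ! : ℝ)) ^ 2 * (2 * (2 * (2 * (2 ^ 10 * (1 : ℝ) * (4 : ℝ) ^
      nScales β) + 2 * (4 * (2 * (4 * (4 + (4 : ℝ) ^ nScales β * Ξ) * (1 + 16 * (1 + (27 / 10 : ℝ)) / (klScale klE0 (nScales β + 1)) * 1) + (2 ^ 10 * (1 : ℝ) * (4 : ℝ) ^ nScales β))) *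
      (1 + 6 / (klScale klE0 (nScales β + 1)) * ((klScale klE0 (nScales β + 1)) / 128 + (5 : ℝ) * (R.Gfr 0 * |U| * Θ * ((16 : ℝ) ^ nScales β)⁻¹))))))) ^ 0 + 2 * (((R.Gfr 0 * |U| * Θ *
      ((16 : ℝ) ^ nScales β)⁻¹) / |(β * (L : ℝ) ^ 2)|) * ((5 : ℝ) * (|(β * (L : ℝ) ^ 2)| * (6 / (klScale klE0 (nScales β + 1))))) * ((0 ! : ℝ)) ^ 2 * (2 * (2 * (2 ^ 10 * (1 : ℝ) * (4 :
      ℝ) ^ nScales β) + 2 * (4 * (2 * (4 * (4 + (4 : ℝ) ^ nScales β * Ξ) * (1 + 16 * (1 + (27 / 10 : ℝ)) / (klScale klE0 (nScales β + 1)) * 1) + (2 ^ 10 * (1 : ℝ) * (4 : ℝ) ^ nScales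
      β))) * (1 + 6 / (klScale klE0 (nScales β + 1)) * ((klScale klE0 (nScales β + 1)) / 128 + (5 : ℝ) * (R.Gfr 0 * |U| * Θ * ((16 : ℝ) ^ nScales β)⁻¹)))))) ^ 0)) * (Msc / (1 + (L : ℝ)
      / 4) ^ s)) ≤ (Nmc * klEngRsq R ^ 8 / 2 ^ 6 + Nsc / 2 ^ 217) * (U ^ 3 / β ^ 2) * ((4 : ℝ) ^ nScales β) ^ j := fun j hj =>
    (lastAliasRowB_le (P := P) hR hR0 hW0 hβmin hU hU1 hΞ hΘ hdoor hL hs hj (hMmc0 j hj) hMsc0).trans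
      (graded_envelope_le hU.le hU1 h128 hl1 (hMmc0 j hj) hMsc0 (hNmc j hj) hNsc)
  have rowC0 : ∀ j ≤ 4, 0 ≤ 2 * (2 * (Mmc j * ((3 : ℝ) ^ j * (((R.Gfr 0 * |U| * Θ * ((16 : ℝ) ^ nScales β)⁻¹) / |(β * (L : ℝ) ^ 2)| * ((5 : ℝ) * (|(β * (L : ℝ) ^ 2)| * (6 / (klScale klE0 (nScales β +
      1)))))) * ((R.Gfr 0 * |U| * Θ * ((16 : ℝ) ^ nScales β)⁻¹) / |(β * (L : ℝ) ^ 2)| * ((5 : ℝ) * (|(β * (L : ℝ) ^ 2)| * (6 / (klScale klE0 (nScales β + 1)))))) * ((26 ! : ℝ)) ^ 2 *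
      (2 * (2 * (2 * (2 ^ 10 * (1 : ℝ) * (4 : ℝ) ^ nScales β) + 2 * (4 * (2 * (4 * (4 + (4 : ℝ) ^ nScales β * Ξ) * (1 + 16 * (1 + (27 / 10 : ℝ)) / (klScale klE0 (nScales β + 1)) * 1) +
      (2 ^ 10 * (1 : ℝ) * (4 : ℝ) ^ nScales β))) * (1 + 6 / (klScale klE0 (nScales β + 1)) * ((klScale klE0 (nScales β + 1)) / 128 + (5 : ℝ) * (R.Gfr 0 * |U| * Θ * ((16 : ℝ) ^ nScales
      β)⁻¹))))))) ^ 26 + 2 * (((R.Gfr 0 * |U| * Θ * ((16 : ℝ) ^ nScales β)⁻¹) / |(β * (L : ℝ) ^ 2)|) * ((5 : ℝ) * (|(β * (L : ℝ) ^ 2)| * (6 / (klScale klE0 (nScales β + 1))))) * ((26 !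
      : ℝ)) ^ 2 * (2 * (2 * (2 ^ 10 * (1 : ℝ) * (4 : ℝ) ^ nScales β) + 2 * (4 * (2 * (4 * (4 + (4 : ℝ) ^ nScales β * Ξ) * (1 + 16 * (1 + (27 / 10 : ℝ)) / (klScale klE0 (nScales β + 1))
      * 1) + (2 ^ 10 * (1 : ℝ) * (4 : ℝ) ^ nScales β))) * (1 + 6 / (klScale klE0 (nScales β + 1)) * ((klScale klE0 (nScales β + 1)) / 128 + (5 : ℝ) * (R.Gfr 0 * |U| * Θ * ((16 : ℝ) ^
      nScales β)⁻¹)))))) ^ 26)) * (2 / ((2 * (L / 4 + 1) : ℕ) : ℝ)) ^ (26 - j - 4) * (2 ^ 2 * ∑' k : Fin 2 → ℤ, ∏ i, (1 + (k i : ℝ) ^ 2)⁻¹)))) + (L : ℝ) ^ 2 * (L : ℝ) ^ j * ((((R.Gfr 0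
      * |U| * Θ * ((16 : ℝ) ^ nScales β)⁻¹) / |(β * (L : ℝ) ^ 2)| * ((5 : ℝ) * (|(β * (L : ℝ) ^ 2)| * (6 / (klScale klE0 (nScales β + 1)))))) * ((R.Gfr 0 * |U| * Θ * ((16 : ℝ) ^
      nScales β)⁻¹) / |(β * (L : ℝ) ^ 2)| * ((5 : ℝ) * (|(β * (L : ℝ) ^ 2)| * (6 / (klScale klE0 (nScales β + 1)))))) * ((0 ! : ℝ)) ^ 2 * (2 * (2 * (2 * (2 ^ 10 * (1 : ℝ) * (4 : ℝ) ^
      nScales β) + 2 * (4 * (2 * (4 * (4 + (4 : ℝ) ^ nScales β * Ξ) * (1 + 16 * (1 + (27 / 10 : ℝ)) / (klScale klE0 (nScales β + 1)) * 1) + (2 ^ 10 * (1 : ℝ) * (4 : ℝ) ^ nScales β))) *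
      (1 + 6 / (klScale klE0 (nScales β + 1)) * ((klScale klE0 (nScales β + 1)) / 128 + (5 : ℝ) * (R.Gfr 0 * |U| * Θ * ((16 : ℝ) ^ nScales β)⁻¹))))))) ^ 0 + 2 * (((R.Gfr 0 * |U| * Θ *
      ((16 : ℝ) ^ nScales β)⁻¹) / |(β * (L : ℝ) ^ 2)|) * ((5 : ℝ) * (|(β * (L : ℝ) ^ 2)| * (6 / (klScale klE0 (nScales β + 1))))) * ((0 ! : ℝ)) ^ 2 * (2 * (2 * (2 ^ 10 * (1 : ℝ) * (4 :
      ℝ) ^ nScales β) + 2 * (4 * (2 * (4 * (4 + (4 : ℝ) ^ nScales β * Ξ) * (1 + 16 * (1 + (27 / 10 : ℝ)) / (klScale klE0 (nScales β + 1)) * 1) + (2 ^ 10 * (1 : ℝ) * (4 : ℝ) ^ nScales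
      β))) * (1 + 6 / (klScale klE0 (nScales β + 1)) * ((klScale klE0 (nScales β + 1)) / 128 + (5 : ℝ) * (R.Gfr 0 * |U| * Θ * ((16 : ℝ) ^ nScales β)⁻¹)))))) ^ 0)) * (Msc / (1 + (L : ℝ)
      / 4) ^ s)) := fun j hj =>
    lastAliasRowB_nonneg hR hR0 hW0 hβmin hΞ hΘ hdoor (s := s) (j := j) (hMmc0 j hj) hMsc0
  -- the curve table of the old flow frame, sharp
  obtain ⟨hD1, hDc1, hDc2, hDc3, hDc4⟩ := flowCurve_table_sharp hR hU.le hU1 (nScales β)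
  have hA₃0 : 0 ≤ (R.Gfr 3 * U ^ 2 * ((4 : ℝ) ^ (nScales β + 1) / 3)) := by have := hR 3; positivity
  have hA₄0 : 0 ≤ (R.Gfr 4 * U ^ 2 * ((16 : ℝ) ^ (nScales β + 1) / 15)) := by have := hR 4; positivity
  obtain ⟨n1, n2, n3, n4⟩ := klCurveD_sizes_nonneg hA₃0 hA₄0
  have hDc0 : ∀ i, 1 ≤ i → i ≤ 4 → 0 ≤ (fun i : ℕ => if i = 1 then klCurveD1 else if i = 2 then klCurveD2 else if i = 3 then klCurveD3 (R.Gfr 3 * U ^ 2 * ((4 : ℝ) ^ (nScales β + 1) / 3)) else klCurveD4 (R.Gfr 3 * U ^ 2 * ((4 : ℝ) ^ (nScales β + 1) / 3)) (R.Gfr 4 * U ^ 2 * ((16 : ℝ) ^ (nScales β + 1) / 15))) i := by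
    intro i hi1 hi4
    interval_cases i
    · exact n1
    · exact n2
    · exact n3
    · exact n4
  -- graded Bell rows of the three channels
  obtain ⟨a0, a1, a2, a3, a4⟩ := bellRows_graded_le (f := fun j : ℕ => 2 * (2 * (1 * ((3 : ℝ) ^ j * (((R.Gfr 0 * |U| * Θ * ((16 : ℝ) ^ nScales β)⁻¹) * (R.Gfr 0 * |U| * Θ * ((16 : ℝ) ^ nScales β)⁻¹) / |(β * (L : ℝ) ^ 2)|) * ((5 : ℝ) * (|(β * (L : ℝ)
      ^ 2)| * (6 / (klScale klE0 (nScales β + 1))))) * ((26 ! : ℝ)) ^ 2 * (2 * (2 * (2 ^ 10 * (1 : ℝ) * (4 : ℝ) ^ nScales β) + 2 * (4 * (2 * (4 * (4 + (4 : ℝ) ^ nScales β * Ξ) * (1 +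
      16 * (1 + (27 / 10 : ℝ)) / (klScale klE0 (nScales β + 1)) * 1) + (2 ^ 10 * (1 : ℝ) * (4 : ℝ) ^ nScales β))) * (1 + 6 / (klScale klE0 (nScales β + 1)) * ((klScale klE0 (nScales β
      + 1)) / 128 + (5 : ℝ) * (R.Gfr 0 * |U| * Θ * ((16 : ℝ) ^ nScales β)⁻¹)))))) ^ 26) * (2 / ((2 * (L / 4 + 1) : ℕ) : ℝ)) ^ (26 - j - 4) * (2 ^ 2 * ∑' k : Fin 2 → ℤ, ∏ i, (1 + (k i :
      ℝ) ^ 2)⁻¹)))) + (L : ℝ) ^ 2 * (L : ℝ) ^ j * ((((R.Gfr 0 * |U| * Θ * ((16 : ℝ) ^ nScales β)⁻¹) * (R.Gfr 0 * |U| * Θ * ((16 : ℝ) ^ nScales β)⁻¹) / |(β * (L : ℝ) ^ 2)|) * ((5 : ℝ) *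
      (|(β * (L : ℝ) ^ 2)| * (6 / (klScale klE0 (nScales β + 1))))) * ((0 ! : ℝ)) ^ 2 * (2 * (2 * (2 ^ 10 * (1 : ℝ) * (4 : ℝ) ^ nScales β) + 2 * (4 * (2 * (4 * (4 + (4 : ℝ) ^ nScales β
      * Ξ) * (1 + 16 * (1 + (27 / 10 : ℝ)) / (klScale klE0 (nScales β + 1)) * 1) + (2 ^ 10 * (1 : ℝ) * (4 : ℝ) ^ nScales β))) * (1 + 6 / (klScale klE0 (nScales β + 1)) * ((klScale klE0
      (nScales β + 1)) / 128 + (5 : ℝ) * (R.Gfr 0 * |U| * Θ * ((16 : ℝ) ^ nScales β)⁻¹)))))) ^ 0) * (1 / (1 + (L : ℝ) / 4) ^ s)))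
    (Dc := (fun i : ℕ => if i = 1 then klCurveD1 else if i = 2 then klCurveD2 else if i = 3 then klCurveD3 (R.Gfr 3 * U ^ 2 * ((4 : ℝ) ^ (nScales β + 1) / 3)) else klCurveD4 (R.Gfr 3 * U ^ 2 * ((4 : ℝ) ^ (nScales β + 1) / 3)) (R.Gfr 4 * U ^ 2 * ((16 : ℝ) ^ (nScales β + 1) / 15)))) hl1 hcA0 hD1 rowA0 rowA hDc0 hDc1 hDc2 hDc3 hDc4
  obtain ⟨b0, b1, b2, b3, b4⟩ := bellRows_graded_le (f := fun j : ℕ => 2 * (2 * (Mmb j * ((3 : ℝ) ^ j * (((R.Gfr 0 * |U| * Θ * ((16 : ℝ) ^ nScales β)⁻¹) / |(β * (L : ℝ) ^ 2)| * ((5 : ℝ) * (|(β * (L : ℝ) ^ 2)| * (6 / (klScale klE0 (nScales β +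
      1)))))) * ((R.Gfr 0 * |U| * Θ * ((16 : ℝ) ^ nScales β)⁻¹) / |(β * (L : ℝ) ^ 2)| * ((5 : ℝ) * (|(β * (L : ℝ) ^ 2)| * (6 / (klScale klE0 (nScales β + 1)))))) * ((26 ! : ℝ)) ^ 2 *
      (2 * (2 * (2 * (2 ^ 10 * (1 : ℝ) * (4 : ℝ) ^ nScales β) + 2 * (4 * (2 * (4 * (4 + (4 : ℝ) ^ nScales β * Ξ) * (1 + 16 * (1 + (27 / 10 : ℝ)) / (klScale klE0 (nScales β + 1)) * 1) +
      (2 ^ 10 * (1 : ℝ) * (4 : ℝ) ^ nScales β))) * (1 + 6 / (klScale klE0 (nScales β + 1)) * ((klScale klE0 (nScales β + 1)) / 128 + (5 : ℝ) * (R.Gfr 0 * |U| * Θ * ((16 : ℝ) ^ nScales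
      β)⁻¹))))))) ^ 26 + 2 * (((R.Gfr 0 * |U| * Θ * ((16 : ℝ) ^ nScales β)⁻¹) / |(β * (L : ℝ) ^ 2)|) * ((5 : ℝ) * (|(β * (L : ℝ) ^ 2)| * (6 / (klScale klE0 (nScales β + 1))))) * ((26 !
      : ℝ)) ^ 2 * (2 * (2 * (2 ^ 10 * (1 : ℝ) * (4 : ℝ) ^ nScales β) + 2 * (4 * (2 * (4 * (4 + (4 : ℝ) ^ nScales β * Ξ) * (1 + 16 * (1 + (27 / 10 : ℝ)) / (klScale klE0 (nScales β + 1))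
      * 1) + (2 ^ 10 * (1 : ℝ) * (4 : ℝ) ^ nScales β))) * (1 + 6 / (klScale klE0 (nScales β + 1)) * ((klScale klE0 (nScales β + 1)) / 128 + (5 : ℝ) * (R.Gfr 0 * |U| * Θ * ((16 : ℝ) ^
      nScales β)⁻¹)))))) ^ 26)) * (2 / ((2 * (L / 4 + 1) : ℕ) : ℝ)) ^ (26 - j - 4) * (2 ^ 2 * ∑' k : Fin 2 → ℤ, ∏ i, (1 + (k i : ℝ) ^ 2)⁻¹)))) + (L : ℝ) ^ 2 * (L : ℝ) ^ j * ((((R.Gfr 0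
      * |U| * Θ * ((16 : ℝ) ^ nScales β)⁻¹) / |(β * (L : ℝ) ^ 2)| * ((5 : ℝ) * (|(β * (L : ℝ) ^ 2)| * (6 / (klScale klE0 (nScales β + 1)))))) * ((R.Gfr 0 * |U| * Θ * ((16 : ℝ) ^
      nScales β)⁻¹) / |(β * (L : ℝ) ^ 2)| * ((5 : ℝ) * (|(β * (L : ℝ) ^ 2)| * (6 / (klScale klE0 (nScales β + 1)))))) * ((0 ! : ℝ)) ^ 2 * (2 * (2 * (2 * (2 ^ 10 * (1 : ℝ) * (4 : ℝ) ^
      nScales β) + 2 * (4 * (2 * (4 * (4 + (4 : ℝ) ^ nScales β * Ξ) * (1 + 16 * (1 + (27 / 10 : ℝ)) / (klScale klE0 (nScales β + 1)) * 1) + (2 ^ 10 * (1 : ℝ) * (4 : ℝ) ^ nScales β))) *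
      (1 + 6 / (klScale klE0 (nScales β + 1)) * ((klScale klE0 (nScales β + 1)) / 128 + (5 : ℝ) * (R.Gfr 0 * |U| * Θ * ((16 : ℝ) ^ nScales β)⁻¹))))))) ^ 0 + 2 * (((R.Gfr 0 * |U| * Θ *
      ((16 : ℝ) ^ nScales β)⁻¹) / |(β * (L : ℝ) ^ 2)|) * ((5 : ℝ) * (|(β * (L : ℝ) ^ 2)| * (6 / (klScale klE0 (nScales β + 1))))) * ((0 ! : ℝ)) ^ 2 * (2 * (2 * (2 ^ 10 * (1 : ℝ) * (4 :
      ℝ) ^ nScales β) + 2 * (4 * (2 * (4 * (4 + (4 : ℝ) ^ nScales β * Ξ) * (1 + 16 * (1 + (27 / 10 : ℝ)) / (klScale klE0 (nScales β + 1)) * 1) + (2 ^ 10 * (1 : ℝ) * (4 : ℝ) ^ nScales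
      β))) * (1 + 6 / (klScale klE0 (nScales β + 1)) * ((klScale klE0 (nScales β + 1)) / 128 + (5 : ℝ) * (R.Gfr 0 * |U| * Θ * ((16 : ℝ) ^ nScales β)⁻¹)))))) ^ 0)) * (Msb / (1 + (L : ℝ)
      / 4) ^ s)))
    (Dc := (fun i : ℕ => if i = 1 then klCurveD1 else if i = 2 then klCurveD2 else if i = 3 then klCurveD3 (R.Gfr 3 * U ^ 2 * ((4 : ℝ) ^ (nScales β + 1) / 3)) else klCurveD4 (R.Gfr 3 * U ^ 2 * ((4 : ℝ) ^ (nScales β + 1) / 3)) (R.Gfr 4 * U ^ 2 * ((16 : ℝ) ^ (nScales β + 1) / 15)))) hl1 hcB0 hD1 rowB0 rowB hDc0 hDc1 hDc2 hDc3 hDc4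
  obtain ⟨c0, c1, c2, c3, c4⟩ := bellRows_graded_le (f := fun j : ℕ => 2 * (2 * (Mmc j * ((3 : ℝ) ^ j * (((R.Gfr 0 * |U| * Θ * ((16 : ℝ) ^ nScales β)⁻¹) / |(β * (L : ℝ) ^ 2)| * ((5 : ℝ) * (|(β * (L : ℝ) ^ 2)| * (6 / (klScale klE0 (nScales β +
      1)))))) * ((R.Gfr 0 * |U| * Θ * ((16 : ℝ) ^ nScales β)⁻¹) / |(β * (L : ℝ) ^ 2)| * ((5 : ℝ) * (|(β * (L : ℝ) ^ 2)| * (6 / (klScale klE0 (nScales β + 1)))))) * ((26 ! : ℝ)) ^ 2 *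
      (2 * (2 * (2 * (2 ^ 10 * (1 : ℝ) * (4 : ℝ) ^ nScales β) + 2 * (4 * (2 * (4 * (4 + (4 : ℝ) ^ nScales β * Ξ) * (1 + 16 * (1 + (27 / 10 : ℝ)) / (klScale klE0 (nScales β + 1)) * 1) +
      (2 ^ 10 * (1 : ℝ) * (4 : ℝ) ^ nScales β))) * (1 + 6 / (klScale klE0 (nScales β + 1)) * ((klScale klE0 (nScales β + 1)) / 128 + (5 : ℝ) * (R.Gfr 0 * |U| * Θ * ((16 : ℝ) ^ nScales
      β)⁻¹))))))) ^ 26 + 2 * (((R.Gfr 0 * |U| * Θ * ((16 : ℝ) ^ nScales β)⁻¹) / |(β * (L : ℝ) ^ 2)|) * ((5 : ℝ) * (|(β * (L : ℝ) ^ 2)| * (6 / (klScale klE0 (nScales β + 1))))) * ((26 !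
      : ℝ)) ^ 2 * (2 * (2 * (2 ^ 10 * (1 : ℝ) * (4 : ℝ) ^ nScales β) + 2 * (4 * (2 * (4 * (4 + (4 : ℝ) ^ nScales β * Ξ) * (1 + 16 * (1 + (27 / 10 : ℝ)) / (klScale klE0 (nScales β + 1))
      * 1) + (2 ^ 10 * (1 : ℝ) * (4 : ℝ) ^ nScales β))) * (1 + 6 / (klScale klE0 (nScales β + 1)) * ((klScale klE0 (nScales β + 1)) / 128 + (5 : ℝ) * (R.Gfr 0 * |U| * Θ * ((16 : ℝ) ^
      nScales β)⁻¹)))))) ^ 26)) * (2 / ((2 * (L / 4 + 1) : ℕ) : ℝ)) ^ (26 - j - 4) * (2 ^ 2 * ∑' k : Fin 2 → ℤ, ∏ i, (1 + (k i : ℝ) ^ 2)⁻¹)))) + (L : ℝ) ^ 2 * (L : ℝ) ^ j * ((((R.Gfr 0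
      * |U| * Θ * ((16 : ℝ) ^ nScales β)⁻¹) / |(β * (L : ℝ) ^ 2)| * ((5 : ℝ) * (|(β * (L : ℝ) ^ 2)| * (6 / (klScale klE0 (nScales β + 1)))))) * ((R.Gfr 0 * |U| * Θ * ((16 : ℝ) ^
      nScales β)⁻¹) / |(β * (L : ℝ) ^ 2)| * ((5 : ℝ) * (|(β * (L : ℝ) ^ 2)| * (6 / (klScale klE0 (nScales β + 1)))))) * ((0 ! : ℝ)) ^ 2 * (2 * (2 * (2 * (2 ^ 10 * (1 : ℝ) * (4 : ℝ) ^
      nScales β) + 2 * (4 * (2 * (4 * (4 + (4 : ℝ) ^ nScales β * Ξ) * (1 + 16 * (1 + (27 / 10 : ℝ)) / (klScale klE0 (nScales β + 1)) * 1) + (2 ^ 10 * (1 : ℝ) * (4 : ℝ) ^ nScales β))) *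
      (1 + 6 / (klScale klE0 (nScales β + 1)) * ((klScale klE0 (nScales β + 1)) / 128 + (5 : ℝ) * (R.Gfr 0 * |U| * Θ * ((16 : ℝ) ^ nScales β)⁻¹))))))) ^ 0 + 2 * (((R.Gfr 0 * |U| * Θ *
      ((16 : ℝ) ^ nScales β)⁻¹) / |(β * (L : ℝ) ^ 2)|) * ((5 : ℝ) * (|(β * (L : ℝ) ^ 2)| * (6 / (klScale klE0 (nScales β + 1))))) * ((0 ! : ℝ)) ^ 2 * (2 * (2 * (2 ^ 10 * (1 : ℝ) * (4 :
      ℝ) ^ nScales β) + 2 * (4 * (2 * (4 * (4 + (4 : ℝ) ^ nScales β * Ξ) * (1 + 16 * (1 + (27 / 10 : ℝ)) / (klScale klE0 (nScales β + 1)) * 1) + (2 ^ 10 * (1 : ℝ) * (4 : ℝ) ^ nScales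
      β))) * (1 + 6 / (klScale klE0 (nScales β + 1)) * ((klScale klE0 (nScales β + 1)) / 128 + (5 : ℝ) * (R.Gfr 0 * |U| * Θ * ((16 : ℝ) ^ nScales β)⁻¹)))))) ^ 0)) * (Msc / (1 + (L : ℝ)
      / 4) ^ s)))
    (Dc := (fun i : ℕ => if i = 1 then klCurveD1 else if i = 2 then klCurveD2 else if i = 3 then klCurveD3 (R.Gfr 3 * U ^ 2 * ((4 : ℝ) ^ (nScales β + 1) / 3)) else klCurveD4 (R.Gfr 3 * U ^ 2 * ((4 : ℝ) ^ (nScales β + 1) / 3)) (R.Gfr 4 * U ^ 2 * ((16 : ℝ) ^ (nScales β + 1) / 15)))) hl1 hcC0 hD1 rowC0 rowC hDc0 hDc1 hDc2 hDc3 hDc4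
  -- the size rows against the explicit `ZA_X`
  have hP40 : (0 : ℝ) ≤ ((231 : ℝ) ^ 4 + 6 * 231 ^ 2 * 700000 + 3 * 700000 ^ 2 + 4 * 231 * (10 ^ 14 * (1 + R.Gfr 3 + R.Gfr 4)) + (10 ^ 14 * (1 + R.Gfr 3 + R.Gfr 4))) := by have := hR 3; have := hR 4; positivity
  have sA' : (klEngRsq R ^ 8 / 2 ^ 17 * (U ^ 3 / β ^ 2)) * ((231 : ℝ) ^ 4 + 6 * 231 ^ 2 * 700000 + 3 * 700000 ^ 2 + 4 * 231 * (10 ^ 14 * (1 + R.Gfr 3 + R.Gfr 4)) + (10 ^ 14 * (1 + R.Gfr 3 + R.Gfr 4))) * ((4 : ℝ) ^ nScales β) ^ 2 ≤ (klEngRsq R ^ 8 * (1696963596321 + 925 * (10 ^ 14 * (1 + R.Gfr 3 + R.Gfr 4))) / 2 ^ 30) * U ^ 3 :=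
    (channelConst_le hβmin (div_nonneg hRsq8 (by norm_num)) hP40 hU.le).trans (le_of_eq (by ring))
  have sB' : ((Nmb * klEngRsq R ^ 8 / 2 ^ 6 + Nsb / 2 ^ 217) * (U ^ 3 / β ^ 2)) * ((231 : ℝ) ^ 4 + 6 * 231 ^ 2 * 700000 + 3 * 700000 ^ 2 + 4 * 231 * (10 ^ 14 * (1 + R.Gfr 3 + R.Gfr 4)) + (10 ^ 14 * (1 + R.Gfr 3 + R.Gfr 4))) * ((4 : ℝ) ^ nScales β) ^ 2 ≤ ((Nmb * klEngRsq R ^ 8 / 2 ^ 6 + Nsb / 2 ^ 217) * (1696963596321 + 925 * (10 ^ 14 * (1 + R.Gfr 3 + R.Gfr 4))) / 2 ^ 13) * U ^ 3 :=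
    (channelConst_le hβmin (add_nonneg (div_nonneg (mul_nonneg hNmb0 hRsq8) (by norm_num)) (div_nonneg hNsb0 (by norm_num))) hP40 hU.le).trans
      (le_of_eq (by ring))
  have sC' : ((Nmc * klEngRsq R ^ 8 / 2 ^ 6 + Nsc / 2 ^ 217) * (U ^ 3 / β ^ 2)) * ((231 : ℝ) ^ 4 + 6 * 231 ^ 2 * 700000 + 3 * 700000 ^ 2 + 4 * 231 * (10 ^ 14 * (1 + R.Gfr 3 + R.Gfr 4)) + (10 ^ 14 * (1 + R.Gfr 3 + R.Gfr 4))) * ((4 : ℝ) ^ nScales β) ^ 2 ≤ ((Nmc * klEngRsq R ^ 8 / 2 ^ 6 + Nsc / 2 ^ 217) * (1696963596321 + 925 * (10 ^ 14 * (1 + R.Gfr 3 + R.Gfr 4))) / 2 ^ 13) * U ^ 3 :=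
    (channelConst_le hβmin (add_nonneg (div_nonneg (mul_nonneg hNmc0 hRsq8) (by norm_num)) (div_nonneg hNsc0 (by norm_num))) hP40 hU.le).trans
      (le_of_eq (by ring))
  have sA := fun (k : ℕ) (_ : k ≤ 4) => sizeRow_of_graded hl0 sA' k
  have sB := fun (k : ℕ) (_ : k ≤ 4) => sizeRow_of_graded hl0 sB' k
  have sC := fun (k : ℕ) (_ : k ≤ 4) => sizeRow_of_graded hl0 sC' k
  exact lastResponse_bracket_flow_sharp_env hR hc hcle hU hU1 hUle hβmin hβc hμ hK hGS hQS hR0 hPh hT hW hΞ hΘ hdoor hZn hZt hZtU hCU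
    (Mg := 26) (by norm_num) le_rfl le_rfl le_rfl le_rfl hMmb hMsb le_rfl le_rfl hMmc hMsc
    (ALa := fun j : ℕ => 2 * (2 * (1 * ((3 : ℝ) ^ j * (((R.Gfr 0 * |U| * Θ * ((16 : ℝ) ^ nScales β)⁻¹) * (R.Gfr 0 * |U| * Θ * ((16 : ℝ) ^ nScales β)⁻¹) / |(β * (L : ℝ) ^ 2)|) * ((5 : ℝ) * (|(β * (L : ℝ)
      ^ 2)| * (6 / (klScale klE0 (nScales β + 1))))) * ((26 ! : ℝ)) ^ 2 * (2 * (2 * (2 ^ 10 * (1 : ℝ) * (4 : ℝ) ^ nScales β) + 2 * (4 * (2 * (4 * (4 + (4 : ℝ) ^ nScales β * Ξ) * (1 +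
      16 * (1 + (27 / 10 : ℝ)) / (klScale klE0 (nScales β + 1)) * 1) + (2 ^ 10 * (1 : ℝ) * (4 : ℝ) ^ nScales β))) * (1 + 6 / (klScale klE0 (nScales β + 1)) * ((klScale klE0 (nScales β
      + 1)) / 128 + (5 : ℝ) * (R.Gfr 0 * |U| * Θ * ((16 : ℝ) ^ nScales β)⁻¹)))))) ^ 26) * (2 / ((2 * (L / 4 + 1) : ℕ) : ℝ)) ^ (26 - j - 4) * (2 ^ 2 * ∑' k : Fin 2 → ℤ, ∏ i, (1 + (k i :
      ℝ) ^ 2)⁻¹)))) + (L : ℝ) ^ 2 * (L : ℝ) ^ j * ((((R.Gfr 0 * |U| * Θ * ((16 : ℝ) ^ nScales β)⁻¹) * (R.Gfr 0 * |U| * Θ * ((16 : ℝ) ^ nScales β)⁻¹) / |(β * (L : ℝ) ^ 2)|) * ((5 : ℝ) *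
      (|(β * (L : ℝ) ^ 2)| * (6 / (klScale klE0 (nScales β + 1))))) * ((0 ! : ℝ)) ^ 2 * (2 * (2 * (2 ^ 10 * (1 : ℝ) * (4 : ℝ) ^ nScales β) + 2 * (4 * (2 * (4 * (4 + (4 : ℝ) ^ nScales β
      * Ξ) * (1 + 16 * (1 + (27 / 10 : ℝ)) / (klScale klE0 (nScales β + 1)) * 1) + (2 ^ 10 * (1 : ℝ) * (4 : ℝ) ^ nScales β))) * (1 + 6 / (klScale klE0 (nScales β + 1)) * ((klScale klE0
      (nScales β + 1)) / 128 + (5 : ℝ) * (R.Gfr 0 * |U| * Θ * ((16 : ℝ) ^ nScales β)⁻¹)))))) ^ 0) * (1 / (1 + (L : ℝ) / 4) ^ s)))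
    (fun j _ => le_rfl)
    (AAa := fun k : ℕ => klEngRsq R ^ 8 / 2 ^ 17 * (U ^ 3 / β ^ 2) * ((231 : ℝ) ^ 4 + 6 * 231 ^ 2 * 700000 + 3 * 700000 ^ 2 + 4 * 231 * (10 ^ 14 * (1 + R.Gfr 3 + R.Gfr 4)) + (10 ^ 14 * (1 + R.Gfr 3 + R.Gfr 4))) * ((4 : ℝ) ^ nScales β) ^ k)
    a0 a1 a2 a3 a4
    (ALb := fun j : ℕ => 2 * (2 * (Mmb j * ((3 : ℝ) ^ j * (((R.Gfr 0 * |U| * Θ * ((16 : ℝ) ^ nScales β)⁻¹) / |(β * (L : ℝ) ^ 2)| * ((5 : ℝ) * (|(β * (L : ℝ) ^ 2)| * (6 / (klScale klE0 (nScales β +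
      1)))))) * ((R.Gfr 0 * |U| * Θ * ((16 : ℝ) ^ nScales β)⁻¹) / |(β * (L : ℝ) ^ 2)| * ((5 : ℝ) * (|(β * (L : ℝ) ^ 2)| * (6 / (klScale klE0 (nScales β + 1)))))) * ((26 ! : ℝ)) ^ 2 *
      (2 * (2 * (2 * (2 ^ 10 * (1 : ℝ) * (4 : ℝ) ^ nScales β) + 2 * (4 * (2 * (4 * (4 + (4 : ℝ) ^ nScales β * Ξ) * (1 + 16 * (1 + (27 / 10 : ℝ)) / (klScale klE0 (nScales β + 1)) * 1) +
      (2 ^ 10 * (1 : ℝ) * (4 : ℝ) ^ nScales β))) * (1 + 6 / (klScale klE0 (nScales β + 1)) * ((klScale klE0 (nScales β + 1)) / 128 + (5 : ℝ) * (R.Gfr 0 * |U| * Θ * ((16 : ℝ) ^ nScales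
      β)⁻¹))))))) ^ 26 + 2 * (((R.Gfr 0 * |U| * Θ * ((16 : ℝ) ^ nScales β)⁻¹) / |(β * (L : ℝ) ^ 2)|) * ((5 : ℝ) * (|(β * (L : ℝ) ^ 2)| * (6 / (klScale klE0 (nScales β + 1))))) * ((26 !
      : ℝ)) ^ 2 * (2 * (2 * (2 ^ 10 * (1 : ℝ) * (4 : ℝ) ^ nScales β) + 2 * (4 * (2 * (4 * (4 + (4 : ℝ) ^ nScales β * Ξ) * (1 + 16 * (1 + (27 / 10 : ℝ)) / (klScale klE0 (nScales β + 1))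
      * 1) + (2 ^ 10 * (1 : ℝ) * (4 : ℝ) ^ nScales β))) * (1 + 6 / (klScale klE0 (nScales β + 1)) * ((klScale klE0 (nScales β + 1)) / 128 + (5 : ℝ) * (R.Gfr 0 * |U| * Θ * ((16 : ℝ) ^
      nScales β)⁻¹)))))) ^ 26)) * (2 / ((2 * (L / 4 + 1) : ℕ) : ℝ)) ^ (26 - j - 4) * (2 ^ 2 * ∑' k : Fin 2 → ℤ, ∏ i, (1 + (k i : ℝ) ^ 2)⁻¹)))) + (L : ℝ) ^ 2 * (L : ℝ) ^ j * ((((R.Gfr 0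
      * |U| * Θ * ((16 : ℝ) ^ nScales β)⁻¹) / |(β * (L : ℝ) ^ 2)| * ((5 : ℝ) * (|(β * (L : ℝ) ^ 2)| * (6 / (klScale klE0 (nScales β + 1)))))) * ((R.Gfr 0 * |U| * Θ * ((16 : ℝ) ^
      nScales β)⁻¹) / |(β * (L : ℝ) ^ 2)| * ((5 : ℝ) * (|(β * (L : ℝ) ^ 2)| * (6 / (klScale klE0 (nScales β + 1)))))) * ((0 ! : ℝ)) ^ 2 * (2 * (2 * (2 * (2 ^ 10 * (1 : ℝ) * (4 : ℝ) ^
      nScales β) + 2 * (4 * (2 * (4 * (4 + (4 : ℝ) ^ nScales β * Ξ) * (1 + 16 * (1 + (27 / 10 : ℝ)) / (klScale klE0 (nScales β + 1)) * 1) + (2 ^ 10 * (1 : ℝ) * (4 : ℝ) ^ nScales β))) *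
      (1 + 6 / (klScale klE0 (nScales β + 1)) * ((klScale klE0 (nScales β + 1)) / 128 + (5 : ℝ) * (R.Gfr 0 * |U| * Θ * ((16 : ℝ) ^ nScales β)⁻¹))))))) ^ 0 + 2 * (((R.Gfr 0 * |U| * Θ *
      ((16 : ℝ) ^ nScales β)⁻¹) / |(β * (L : ℝ) ^ 2)|) * ((5 : ℝ) * (|(β * (L : ℝ) ^ 2)| * (6 / (klScale klE0 (nScales β + 1))))) * ((0 ! : ℝ)) ^ 2 * (2 * (2 * (2 ^ 10 * (1 : ℝ) * (4 :
      ℝ) ^ nScales β) + 2 * (4 * (2 * (4 * (4 + (4 : ℝ) ^ nScales β * Ξ) * (1 + 16 * (1 + (27 / 10 : ℝ)) / (klScale klE0 (nScales β + 1)) * 1) + (2 ^ 10 * (1 : ℝ) * (4 : ℝ) ^ nScales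
      β))) * (1 + 6 / (klScale klE0 (nScales β + 1)) * ((klScale klE0 (nScales β + 1)) / 128 + (5 : ℝ) * (R.Gfr 0 * |U| * Θ * ((16 : ℝ) ^ nScales β)⁻¹)))))) ^ 0)) * (Msb / (1 + (L : ℝ)
      / 4) ^ s)))
    (fun j _ => le_rfl) hPPb0 hPPb1 hPPb2 hPPb3 hPPb4
    (AAb := fun k : ℕ => (Nmb * klEngRsq R ^ 8 / 2 ^ 6 + Nsb / 2 ^ 217) * (U ^ 3 / β ^ 2) * ((231 : ℝ) ^ 4 + 6 * 231 ^ 2 * 700000 + 3 * 700000 ^ 2 + 4 * 231 * (10 ^ 14 * (1 + R.Gfr 3 + R.Gfr 4)) + (10 ^ 14 * (1 + R.Gfr 3 + R.Gfr 4))) * ((4 : ℝ) ^ nScales β) ^ k)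
    b0 b1 b2 b3 b4
    (ALc := fun j : ℕ => 2 * (2 * (Mmc j * ((3 : ℝ) ^ j * (((R.Gfr 0 * |U| * Θ * ((16 : ℝ) ^ nScales β)⁻¹) / |(β * (L : ℝ) ^ 2)| * ((5 : ℝ) * (|(β * (L : ℝ) ^ 2)| * (6 / (klScale klE0 (nScales β +
      1)))))) * ((R.Gfr 0 * |U| * Θ * ((16 : ℝ) ^ nScales β)⁻¹) / |(β * (L : ℝ) ^ 2)| * ((5 : ℝ) * (|(β * (L : ℝ) ^ 2)| * (6 / (klScale klE0 (nScales β + 1)))))) * ((26 ! : ℝ)) ^ 2 *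
      (2 * (2 * (2 * (2 ^ 10 * (1 : ℝ) * (4 : ℝ) ^ nScales β) + 2 * (4 * (2 * (4 * (4 + (4 : ℝ) ^ nScales β * Ξ) * (1 + 16 * (1 + (27 / 10 : ℝ)) / (klScale klE0 (nScales β + 1)) * 1) +
      (2 ^ 10 * (1 : ℝ) * (4 : ℝ) ^ nScales β))) * (1 + 6 / (klScale klE0 (nScales β + 1)) * ((klScale klE0 (nScales β + 1)) / 128 + (5 : ℝ) * (R.Gfr 0 * |U| * Θ * ((16 : ℝ) ^ nScales
      β)⁻¹))))))) ^ 26 + 2 * (((R.Gfr 0 * |U| * Θ * ((16 : ℝ) ^ nScales β)⁻¹) / |(β * (L : ℝ) ^ 2)|) * ((5 : ℝ) * (|(β * (L : ℝ) ^ 2)| * (6 / (klScale klE0 (nScales β + 1))))) * ((26 !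
      : ℝ)) ^ 2 * (2 * (2 * (2 ^ 10 * (1 : ℝ) * (4 : ℝ) ^ nScales β) + 2 * (4 * (2 * (4 * (4 + (4 : ℝ) ^ nScales β * Ξ) * (1 + 16 * (1 + (27 / 10 : ℝ)) / (klScale klE0 (nScales β + 1))
      * 1) + (2 ^ 10 * (1 : ℝ) * (4 : ℝ) ^ nScales β))) * (1 + 6 / (klScale klE0 (nScales β + 1)) * ((klScale klE0 (nScales β + 1)) / 128 + (5 : ℝ) * (R.Gfr 0 * |U| * Θ * ((16 : ℝ) ^
      nScales β)⁻¹)))))) ^ 26)) * (2 / ((2 * (L / 4 + 1) : ℕ) : ℝ)) ^ (26 - j - 4) * (2 ^ 2 * ∑' k : Fin 2 → ℤ, ∏ i, (1 + (k i : ℝ) ^ 2)⁻¹)))) + (L : ℝ) ^ 2 * (L : ℝ) ^ j * ((((R.Gfr 0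
      * |U| * Θ * ((16 : ℝ) ^ nScales β)⁻¹) / |(β * (L : ℝ) ^ 2)| * ((5 : ℝ) * (|(β * (L : ℝ) ^ 2)| * (6 / (klScale klE0 (nScales β + 1)))))) * ((R.Gfr 0 * |U| * Θ * ((16 : ℝ) ^
      nScales β)⁻¹) / |(β * (L : ℝ) ^ 2)| * ((5 : ℝ) * (|(β * (L : ℝ) ^ 2)| * (6 / (klScale klE0 (nScales β + 1)))))) * ((0 ! : ℝ)) ^ 2 * (2 * (2 * (2 * (2 ^ 10 * (1 : ℝ) * (4 : ℝ) ^
      nScales β) + 2 * (4 * (2 * (4 * (4 + (4 : ℝ) ^ nScales β * Ξ) * (1 + 16 * (1 + (27 / 10 : ℝ)) / (klScale klE0 (nScales β + 1)) * 1) + (2 ^ 10 * (1 : ℝ) * (4 : ℝ) ^ nScales β))) *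
      (1 + 6 / (klScale klE0 (nScales β + 1)) * ((klScale klE0 (nScales β + 1)) / 128 + (5 : ℝ) * (R.Gfr 0 * |U| * Θ * ((16 : ℝ) ^ nScales β)⁻¹))))))) ^ 0 + 2 * (((R.Gfr 0 * |U| * Θ *
      ((16 : ℝ) ^ nScales β)⁻¹) / |(β * (L : ℝ) ^ 2)|) * ((5 : ℝ) * (|(β * (L : ℝ) ^ 2)| * (6 / (klScale klE0 (nScales β + 1))))) * ((0 ! : ℝ)) ^ 2 * (2 * (2 * (2 ^ 10 * (1 : ℝ) * (4 :
      ℝ) ^ nScales β) + 2 * (4 * (2 * (4 * (4 + (4 : ℝ) ^ nScales β * Ξ) * (1 + 16 * (1 + (27 / 10 : ℝ)) / (klScale klE0 (nScales β + 1)) * 1) + (2 ^ 10 * (1 : ℝ) * (4 : ℝ) ^ nScales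
      β))) * (1 + 6 / (klScale klE0 (nScales β + 1)) * ((klScale klE0 (nScales β + 1)) / 128 + (5 : ℝ) * (R.Gfr 0 * |U| * Θ * ((16 : ℝ) ^ nScales β)⁻¹)))))) ^ 0)) * (Msc / (1 + (L : ℝ)
      / 4) ^ s)))
    (fun j _ => le_rfl) hPPc0 hPPc1 hPPc2 hPPc3 hPPc4
    (AAc := fun k : ℕ => (Nmc * klEngRsq R ^ 8 / 2 ^ 6 + Nsc / 2 ^ 217) * (U ^ 3 / β ^ 2) * ((231 : ℝ) ^ 4 + 6 * 231 ^ 2 * 700000 + 3 * 700000 ^ 2 + 4 * 231 * (10 ^ 14 * (1 + R.Gfr 3 + R.Gfr 4)) + (10 ^ 14 * (1 + R.Gfr 3 + R.Gfr 4))) * ((4 : ℝ) ^ nScales β) ^ k)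
    c0 c1 c2 c3 c4 hPPbs hPPcs sA sB sC

end FlowSharpAlias

end Summit.HubbardSuperconductivity.HubbardSuperconductivity.Theorems.EngineV8

end
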